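import Summits.ABC.IUTFork.Conditional.AbcOfSGenuine
import Summits.ABC.IUTFork.Cor312ProvenanceDHWitness
import HarnessLib

/-!
# Branch C certificate AT THE GENUINE SETTING — the provenance binder `hX` DISCHARGED at the datum's OWN pilot data (`cor312Of_of_SH_genuine_own`)

PROOF-ONLY sibling (0 definitions) of `Conditional/AbcOfSGenuine.lean` (p430884, abc-iut-C-cert-2: `cor312Of_of_SH_genuine`, per datum
S_H 1 · PIN 1 (+ idele side 5) · READ 4 = 11 named). Writer abc-iut-C-cert-1 (STATUS 08:14Z row «hX-DISCHARGE»). Here the Dupuy–Hilado pilot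
data are FIXED to the datum's OWN pilot data over `F`, `X := Cor312Prov.pilotDataOfF D` (abc-iut-c312-8, `Cor312ProvenanceDHWitness` p418726:
`j_E := j(E)`, `S := 𝕍(F)^bad`, `ord_v(q_v) := ord_v(Δ_min)`), so that the provenance binder `hX : IsPilotDataOf D X` is the THEOREM
`Cor312Prov.isPilotDataOf_pilotDataOfF D` and drops out: per datum S_H 1 · PIN 1 (+ side 5) · READ 3 (hI, hplaces, hΘ≤) = 10 named.
Everything else verbatim (c312-7's `Real.settingPrVolSharp` over c312-5's `LatticeSituation.ofShells`, hull-level clause `PilotKummerCompatHull`,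
q-pin, realising q-ideles, one-sided Θ-identification). Antecedent status unchanged (branch-C finding of record C-R10a/C-R13: interface-NV;
at honest genuine data = the typed Corollary's Θ-side inequality, `Conditional/AbcOfSGenuineAntecedent.lean` p431727). No side taken on [IUTchIII]
Cor. 3.12 or any author; typed ≠ proved; instantiated ≠ endorsed. [claim: Mochizuki2012, status: disputed]
-/

noncomputable section

namespace Summit.ABC.IUTFork.Conditional

open Thm311 Thm311.Real Cor312 Cor312Vol Cor312Prov
open Literature.IUT.LogThetaLattice Literature.IUT.LogVolume Literature.IUT.HodgeTheaters
open Literature.NumberTheory.DiophantineGeometry.GenEll NumberField IsDedekindDomain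

/-- **Per-datum certificate (hull-level line S_H) at the genuine setting built on the datum's OWN pilot data `pilotDataOfF D`** —
`cor312Of_of_SH_genuine` with `X := pilotDataOfF D` and `hX` supplied by `isPilotDataOf_pilotDataOfF D` (abc-iut-c312-8). Remaining named
Props: [S_H] `hSH` · [PIN] `hQPin` + idele side conditions `htq0 htq1 htq ht0 ht1` · [READ] `hI`, `hplaces`, `hΘ` (one-sided). «`I.Cor312Of`
follows from these hypotheses as typed», nothing more; no side taken. [claim: Mochizuki2012, status: disputed] -/
theorem cor312Of_of_SH_genuine_own
    -- the genuine Θ-data and its volume input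
    {F K Fbar : Type} [Field F] [NumberField F] [Field K] [NumberField K] [Algebra F K] [Field Fbar] [Algebra F Fbar]
    [Algebra K Fbar] {E : WeierstrassCurve F} [E.IsElliptic] {l : ℕ} {Pb : BadPlacePredicates K}
    (D : InitialThetaData F K Fbar E l Pb) (I : ThetaVolumeInput (fieldOfModuli E) K)
    -- Dupuy–Hilado pilot data over F and the data of the print-normalised assembled real setting (abc-iut-c312-7's binders)
    (M : Type) [Field M] [NumberField M]
    (archPk : ∀ (j : (thetaIndex (pilotDataOfF D)).Label) (vQ : (thetaIndex (pilotDataOfF D)).VQ), Set ((logShellsDH (pilotDataOfF D) (analyticLogv F)).Packet j vQ))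
    (archSub : ∀ (j : (thetaIndex (pilotDataOfF D)).Label) (v : (thetaIndex (pilotDataOfF D)).V),
      Set ((logShellsDH (pilotDataOfF D) (analyticLogv F)).Packet j ((thetaIndex (pilotDataOfF D)).over v)))
    (Ψ : ℤ → ∀ v : (thetaIndex (pilotDataOfF D)).V, v ∈ (thetaIndex (pilotDataOfF D)).Vbad → Set ((logShellsDH (pilotDataOfF D) (analyticLogv F)).StarPacket v))
    (act : ℤ → ∀ v : (thetaIndex (pilotDataOfF D)).V, v ∈ (thetaIndex (pilotDataOfF D)).Vbad →
      (logShellsDH (pilotDataOfF D) (analyticLogv F)).StarPacket v → Module.End ℚ ((logShellsDH (pilotDataOfF D) (analyticLogv F)).StarPacket v))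
    (Mmod : ℤ → ∀ j : (thetaIndex (pilotDataOfF D)).LabelStar, Set ((logShellsDH (pilotDataOfF D) (analyticLogv F)).GlobalPacket j.1))
    (region : ℤ → ∀ j : (thetaIndex (pilotDataOfF D)).LabelStar, FinDivisor M → ∀ vQ : (thetaIndex (pilotDataOfF D)).VQ,
      Set ((logShellsDH (pilotDataOfF D) (analyticLogv F)).Packet j.1 vQ))
    -- the Frobenius-like column binders of abc-iut-c312-5's `LatticeSituation.ofShells`
    (frobAdm : ℤ → ℤ → ∀ (j : (thetaIndex (pilotDataOfF D)).Label) (vQ : (thetaIndex (pilotDataOfF D)).VQ),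
      Set ((logShellsDH (pilotDataOfF D) (analyticLogv F)).Packet j vQ) → Prop)
    (frobLogvol : ℤ → ℤ → ∀ (j : (thetaIndex (pilotDataOfF D)).Label) (vQ : (thetaIndex (pilotDataOfF D)).VQ),
      Set ((logShellsDH (pilotDataOfF D) (analyticLogv F)).Packet j vQ) → ℝ)
    (frobΨ : ℤ → ℤ → ∀ v : (thetaIndex (pilotDataOfF D)).V, v ∈ (thetaIndex (pilotDataOfF D)).Vbad → Set ((logShellsDH (pilotDataOfF D) (analyticLogv F)).StarPacket v))
    (frobMmod : ℤ → ℤ → ∀ j : (thetaIndex (pilotDataOfF D)).LabelStar, Set ((logShellsDH (pilotDataOfF D) (analyticLogv F)).GlobalPacket j.1))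
    (unitImage : ℤ → ℤ → ℕ → ∀ (j : (thetaIndex (pilotDataOfF D)).Label) (vQ : (thetaIndex (pilotDataOfF D)).VQ),
      Set ((logShellsDH (pilotDataOfF D) (analyticLogv F)).Packet j vQ))
    (ballImage : ℤ → ℤ → ∀ (j : (thetaIndex (pilotDataOfF D)).Label) (vQ : (thetaIndex (pilotDataOfF D)).VQ),
      Set ((logShellsDH (pilotDataOfF D) (analyticLogv F)).Packet j vQ))
    (thetaDiv : ℤ → ℤ → LgpDivisor M (thetaIndex (pilotDataOfF D)).lstar)
    (n : ℤ) {HT : Type} {LogLink : HT → HT → Type} {IsFull : ∀ {s t : HT}, LogLink s t → Prop}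
    (lat : LGPGaussianLogThetaLattice LogLink IsFull)
    {Frd : Type} {IsoF : Frd → Frd → Type} {Ob : Frd → Type} {realify : Frd → Frd} {Strip : Type}
    {IsoS : Strip → Strip → Type} {Mv : ∀ v : (thetaIndex (pilotDataOfF D)).V, v ∈ (thetaIndex (pilotDataOfF D)).Vbad → Type}
    [∀ v h, Monoid (Mv v h)]
    (sig : GlobalLGPFrobenioidSignature (thetaIndex (pilotDataOfF D)).lstar (thetaIndex (pilotDataOfF D)).V (· ∈ (thetaIndex (pilotDataOfF D)).Vbad)
      Frd IsoF Ob realify Strip IsoS Mv)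
    (split : SplittingMonoids Mv) {ObΔ : Type} {N : ∀ v : (thetaIndex (pilotDataOfF D)).V, v ∈ (thetaIndex (pilotDataOfF D)).Vbad → Type}
    [∀ v h, Monoid (N v h)] (qData : QPilotData ObΔ N)
    -- the ideles: q-pilot `tq` and Θ-pilot `t`
    (tq : ∀ (pp : Nat.Primes) (x : (thetaIndex (pilotDataOfF D)).Fibre (.inr pp)), haveI : Fact (pp : ℕ).Prime := ⟨pp.2⟩; kOf (pilotDataOfF D) pp.1 x)
    (t : ∀ (pp : Nat.Primes) (_ : Fin (pilotDataOfF D).lstar) (x : (thetaIndex (pilotDataOfF D)).Fibre (.inr pp)),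
      haveI : Fact (pp : ℕ).Prime := ⟨pp.2⟩; kOf (pilotDataOfF D) pp.1 x)
    -- PR-1's region reading and q-pilot Kummer datum on the real star packets
    (ρ : (∀ v : (thetaIndex (pilotDataOfF D)).V, v ∈ (thetaIndex (pilotDataOfF D)).Vbad → Set ((logShellsDH (pilotDataOfF D) (analyticLogv F)).StarPacket v)) →
      ∀ (j : (thetaIndex (pilotDataOfF D)).Label) (vQ : (thetaIndex (pilotDataOfF D)).VQ), Set ((logShellsDH (pilotDataOfF D) (analyticLogv F)).Packet j vQ))
    (qK : ∀ v : (thetaIndex (pilotDataOfF D)).V, v ∈ (thetaIndex (pilotDataOfF D)).Vbad → Set ((logShellsDH (pilotDataOfF D) (analyticLogv F)).StarPacket v))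
    -- [PIN-side] idele side conditions (non-zero; units off S; `tq` realises P_q in Dupuy–Hilado's normalisation (3.4))
    (htq0 : ∀ pp x, tq pp x ≠ 0)
    (htq1 : ∀ (pp : Nat.Primes) (x : (thetaIndex (pilotDataOfF D)).Fibre (.inr pp)),
      haveI : Fact (pp : ℕ).Prime := ⟨pp.2⟩; placeOf (pilotDataOfF D) pp.1 x ∉ (pilotDataOfF D).S → ‖tq pp x‖ = 1)
    (htq : ∀ (pp : Nat.Primes) (x : (thetaIndex (pilotDataOfF D)).Fibre (.inr pp)),
      haveI : Fact (pp : ℕ).Prime := ⟨pp.2⟩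
      Real.log ‖tq pp x‖ = -((pilotDataOfF D).qPilot (placeOf (pilotDataOfF D) pp.1 x)) * logNorm F (placeOf (pilotDataOfF D) pp.1 x) /
        localDegree F (placeOf (pilotDataOfF D) pp.1 x))
    (ht0 : ∀ pp i x, t pp i x ≠ 0)
    (ht1 : ∀ (pp : Nat.Primes) (i : Fin (pilotDataOfF D).lstar) (x : (thetaIndex (pilotDataOfF D)).Fibre (.inr pp)),
      haveI : Fact (pp : ℕ).Prime := ⟨pp.2⟩; placeOf (pilotDataOfF D) pp.1 x ∉ (pilotDataOfF D).S → ‖t pp i x‖ = 1)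
    -- [READ] provenance: `I` is a volume input OF `D`, `X` is the pilot data OF `D`, the index bijection
    (hI : ThetaData.IsVolumeInputOf D I)
    (hplaces : ∃ e : (thetaIndex (pilotDataOfF D)).V ≃ D.V, ∀ v : (thetaIndex (pilotDataOfF D)).V,
      v ∈ (thetaIndex (pilotDataOfF D)).Vbad ↔ ((e v : D.V) : Val K) ∈ D.Vbad)
    -- [S_H] the HULL-LEVEL printed clause at the genuine setting: the ρ-region of the q-pilot's Kummer datum lies in the Θ-hull
    (hSH : Cor312Vol.PilotKummerCompatHull
      (LatticeSituation.ofShells (logShellsDH (pilotDataOfF D) (analyticLogv F)) M archPk archSub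
        (summandPiecesPr (pilotDataOfF D) (logvAnalytic_analyticLogv (F := F))).Adm
        (summandPiecesPr (pilotDataOfF D) (logvAnalytic_analyticLogv (F := F))).logvol Ψ act Mmod region
        frobAdm frobLogvol frobΨ frobMmod unitImage ballImage thetaDiv)
      (settingPrVolSharp (pilotDataOfF D) (logvAnalytic_analyticLogv (F := F)) M archPk archSub Ψ act Mmod region n lat sig split qData
        tq t htq0 htq1) ρ qK)
    -- [PIN] the q-pin ALONE at the genuine setting
    (hQPin : Cor312Vol.QPinned
      (LatticeSituation.ofShells (logShellsDH (pilotDataOfF D) (analyticLogv F)) M archPk archSub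
        (summandPiecesPr (pilotDataOfF D) (logvAnalytic_analyticLogv (F := F))).Adm
        (summandPiecesPr (pilotDataOfF D) (logvAnalytic_analyticLogv (F := F))).logvol Ψ act Mmod region
        frobAdm frobLogvol frobΨ frobMmod unitImage ballImage thetaDiv)
      (settingPrVolSharp (pilotDataOfF D) (logvAnalytic_analyticLogv (F := F)) M archPk archSub Ψ act Mmod region n lat sig split qData
        tq t htq0 htq1) ρ qK)
    -- [READ] the one-sided Θ-identification (OPEN, C312-RESIDUALS §1a′)
    (hΘ : (settingPrVolSharp (pilotDataOfF D) (logvAnalytic_analyticLogv (F := F)) M archPk archSub Ψ act Mmod region n lat sig split qData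
        tq t htq0 htq1).negLogTheta ≤ ((I.negLogTheta : ℝ) : WithTop ℝ)) :
    I.Cor312Of :=
  cor312Of_of_SH_genuine D I (pilotDataOfF D) M archPk archSub Ψ act Mmod region frobAdm frobLogvol frobΨ frobMmod unitImage
    ballImage thetaDiv n lat sig split qData tq t ρ qK htq0 htq1 htq ht0 ht1 hI (isPilotDataOf_pilotDataOfF D) hplaces hSH hQPin hΘ

end Summit.ABC.IUTFork.Conditional

end
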